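import Mathlib
import HarnessLib
import Literature.MathematicalPhysics.QuantumLattice.HubbardUVSymbolJoint

/-!
# The ultraviolet symbol composed with a `C³` band: derivative bounds of `p ↦ Ψ(ω, u(p))` and of the telescoping integrand
# `p ↦ ∂_eΨ(ω, u(p))·κ(p)` (crude Faà di Bruno with ONE scale parameter)

Topic `MathematicalPhysics/QuantumLattice`; continuation of `HubbardUVSymbolJoint` (`uvSymbol₂ c Λ` on the frequency–band plane, all mixed
derivatives bounded).  For the space moments of the scale-`0` covariance (cell gate-hubbard-kl, K3 engine, clause (E4)₀) the symbol is read along the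
band: `Φ_ω(p) = Ψ(ω, u(p))` for a `Cⁿ` function `u` of the (continuum) momentum `p ∈ ℝ²` — the frame band `e_K`, or one of the PARTIAL frames
`e^{(m)} = ξ − Σ_{n ≤ m} Kp_n` of the telescoping over the frame pieces, whose derivative bounds have the one-scale shape `‖Dⁱu‖ ≤ Dⁱ`
(`D = A·2^m`) — and the mean-value integrand of an increment is `∂_eΨ(ω, u_s(p))·κ(p)` (`κ = -Kp_m`).  With Mathlib's `norm_iteratedFDeriv_comp_le`
(`n!·C·Dⁿ`) and `norm_iteratedFDeriv_mul_le` (Leibniz):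

* `fbPt ω e` (the point `(ω, e)`), `fbPt_apply_zero/one`, `fbLine` (the linear isometry `e ↦ e·e₁`), `fbPt_eq`;
* `norm_iteratedFDeriv_fbPt_comp` — `‖Dⁱ(p ↦ (ω, u p))‖ = ‖Dⁱu‖` (`i ≥ 1`);
* **`norm_iteratedFDeriv_uvSymbol₂_comp_band_le`** — `‖Dⁿ(Ψ(ω, u ·))(p)‖ ≤ n!·C·Dⁿ` when `‖DⁱΨ(ω, u p)‖ ≤ C` (`i ≤ n`) and `‖Dⁱu(p)‖ ≤ Dⁱ` (`1 ≤ i ≤ n`);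
* `uvSymbol₂E` (`∂_eΨ = DΨ(·)(e₁)`), `norm_iteratedFDeriv_uvSymbol₂E_le` (`≤ ‖D^{i+1}Ψ‖`);
* **`norm_iteratedFDeriv_uvSymbol₂E_comp_mul_le`** — `‖Dᵇ(∂_eΨ(ω,u ·)·κ)(p)‖ ≤ Σ_j C(b,j)·(j!·C'·Dʲ)·‖D^{b-j}κ(p)‖` when `‖D^{i+1}Ψ(ω,u p)‖ ≤ C'` (`i ≤ b`).

Everything is proved; `fbPt`, `fbLine`, `uvSymbol₂E` are the only definitions; no named facts.

## Sources

G. Benfatto, A. Giuliani, V. Mastropietro, Ann. Henri Poincaré 7 (2006) 809–898, (2.36aa), §3 (3.2)–(3.8) (`BenfattoGiulianiMastropietro2006`);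
M. Salmhofer, *Renormalization* (1999), §4.2.5 (4.70) (`Salmhofer1999`).
-/

noncomputable section

namespace Literature.MathematicalPhysics.QuantumLattice

open Literature.Probability.LatticeModels Set Complex Filter
open scoped Nat Topology

/-! ### §1 Points and the band line of the frequency–band plane -/

/-- The unit vector `e₁` (band direction) of the plane. [cite: Salmhofer1999, §4.2.5 (4.70)] -/
def fbE1 : FreqBand := EuclideanSpace.single 1 (1 : ℝ)

/-- The unit vector `e₀` (frequency direction) of the plane. [cite: Salmhofer1999, §4.2.5 (4.70)] -/
def fbE0 : FreqBand := EuclideanSpace.single 0 (1 : ℝ)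

/-- The point `(ω, e)` of the plane. [cite: Salmhofer1999, §4.2.5 (4.70)] -/
def fbPt (ω e : ℝ) : FreqBand := ω • fbE0 + e • fbE1

/-- `(ω, e)₀ = ω`. [cite: Salmhofer1999, §4.2.5 (4.70)] -/
@[simp] theorem fbPt_apply_zero (ω e : ℝ) : fbPt ω e 0 = ω := by
  simp [fbPt, fbE0, fbE1]

/-- `(ω, e)₁ = e`. [cite: Salmhofer1999, §4.2.5 (4.70)] -/
@[simp] theorem fbPt_apply_one (ω e : ℝ) : fbPt ω e 1 = e := by
  simp [fbPt, fbE0, fbE1]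

/-- `‖e₁‖ = 1`. [cite: Salmhofer1999, §4.2.5 (4.70)] -/
theorem norm_fbE1 : ‖fbE1‖ = 1 := by
  simp [fbE1]

/-- `‖e₀‖ = 1`. [cite: Salmhofer1999, §4.2.5 (4.70)] -/
theorem norm_fbE0 : ‖fbE0‖ = 1 := by
  simp [fbE0]

/-- The band line as a linear isometry `e ↦ e·e₁`. [cite: Salmhofer1999, §4.2.5 (4.70)] -/
def fbLine : ℝ →ₗᵢ[ℝ] FreqBand where
  toLinearMap := LinearMap.toSpanSingleton ℝ FreqBand fbE1
  norm_map' := fun t => by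
    rw [LinearMap.toSpanSingleton_apply, norm_smul, norm_fbE1, mul_one]

/-- `(ω, e) = (ω, 0) + fbLine e`. [cite: Salmhofer1999, §4.2.5 (4.70)] -/
theorem fbPt_eq (ω e : ℝ) : fbPt ω e = fbPt ω 0 + fbLine e := by
  simp [fbPt, fbLine, LinearMap.toSpanSingleton_apply]

/-- `(ω', e) − (ω, e) = (ω' − ω)·e₀`. [cite: Salmhofer1999, §4.2.5 (4.70)] -/
theorem fbPt_sub_fbPt (ω ω' e : ℝ) : fbPt ω' e - fbPt ω e = (ω' - ω) • fbE0 := by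
  simp only [fbPt, sub_smul]; abel

/-- `Ψ₂(ω, e) = uvSymbolFn c Λ e ω`. [cite: Salmhofer1999, §4.2.5 (4.70)] -/
theorem uvSymbol₂_fbPt (c Λ ω e : ℝ) : uvSymbol₂ c Λ (fbPt ω e) = uvSymbolFn c Λ e ω := by
  rw [uvSymbol₂_apply_eq_uvSymbolFn, fbPt_apply_one, fbPt_apply_zero]

/-! ### §2 The band as a path in the plane: `p ↦ (ω, u(p))` has the derivatives of `u` -/

variable {E : Type*} [NormedAddCommGroup E] [NormedSpace ℝ E]

/-- `p ↦ (ω, u p)` is `Cⁿ` when `u` is. [cite: BenfattoGiulianiMastropietro2006, (2.36aa)] -/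
theorem contDiff_fbPt_comp {n : WithTop ℕ∞} {u : E → ℝ} (hu : ContDiff ℝ n u) (ω : ℝ) : ContDiff ℝ n (fun p => fbPt ω (u p)) := by
  have h : (fun p => fbPt ω (u p)) = fun p => fbPt ω 0 + (fbLine ∘ u) p := funext fun p => by rw [fbPt_eq]; rfl
  rw [h]
  exact contDiff_const.add (fbLine.toContinuousLinearMap.contDiff.comp hu)

/-- **`‖Dⁱ(p ↦ (ω, u p))‖ = ‖Dⁱu‖` for `i ≥ 1`** (a translate of an isometric image). [cite: BenfattoGiulianiMastropietro2006, (2.36aa)] -/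
theorem norm_iteratedFDeriv_fbPt_comp {i : ℕ} (hi : 1 ≤ i) {u : E → ℝ} (hu : ContDiff ℝ i u) (ω : ℝ) (p : E) :
    ‖iteratedFDeriv ℝ i (fun p => fbPt ω (u p)) p‖ = ‖iteratedFDeriv ℝ i u p‖ := by
  have h : (fun p => fbPt ω (u p)) = (fun _ : E => fbPt ω 0) + (fbLine ∘ u) := funext fun p => by rw [Pi.add_apply, fbPt_eq]; rfl
  have hc : ContDiff ℝ i (fbLine ∘ u) := fbLine.toContinuousLinearMap.contDiff.comp hu
  rw [h, iteratedFDeriv_add_apply contDiff_const.contDiffAt hc.contDiffAt]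
  obtain ⟨j, rfl⟩ : ∃ j, i = j + 1 := ⟨i - 1, by omega⟩
  rw [iteratedFDeriv_succ_const, Pi.zero_apply, zero_add, fbLine.norm_iteratedFDeriv_comp_left hu.contDiffAt le_rfl]

/-! ### §3 `Ψ(ω, u(p))`: the crude Faà di Bruno bound -/

/-- **`‖Dⁿ(Ψ(ω, u ·))(p)‖ ≤ n!·C·Dⁿ`** when `‖DⁱΨ‖ ≤ C` at `(ω, u p)` for `i ≤ n` and `‖Dⁱu(p)‖ ≤ Dⁱ` for `1 ≤ i ≤ n` (`Λ > 0`).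
[cite: BenfattoGiulianiMastropietro2006, (2.36aa)] -/
theorem norm_iteratedFDeriv_uvSymbol₂_comp_band_le {c Λ : ℝ} (hΛ : 0 < Λ) {n : ℕ} {u : E → ℝ} (hu : ContDiff ℝ n u) (ω : ℝ) (p : E)
    {C D : ℝ} (hC : ∀ i ≤ n, ‖iteratedFDeriv ℝ i (uvSymbol₂ c Λ) (fbPt ω (u p))‖ ≤ C)
    (hD : ∀ i, 1 ≤ i → i ≤ n → ‖iteratedFDeriv ℝ i u p‖ ≤ D ^ i) :
    ‖iteratedFDeriv ℝ n (fun p => uvSymbol₂ c Λ (fbPt ω (u p))) p‖ ≤ n ! * C * D ^ n := by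
  have h := norm_iteratedFDeriv_comp_le (g := uvSymbol₂ c Λ) (f := fun p => fbPt ω (u p)) (N := (n : ℕ∞))
    (contDiff_uvSymbol₂ c hΛ) (contDiff_fbPt_comp hu ω) le_rfl p hC (fun i hi1 hin => by
      rw [norm_iteratedFDeriv_fbPt_comp hi1 (hu.of_le (by exact_mod_cast hin)) ω p]; exact hD i hi1 hin)
  exact h

/-! ### §4 The band derivative `∂_eΨ` and the telescoping integrand `∂_eΨ(ω, u ·)·κ` -/

/-- The band derivative of the symbol on the plane: `∂_eΨ(x) = DΨ(x)(e₁)`. [cite: Salmhofer1999, §4.2.5 (4.70)] -/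
def uvSymbol₂E (c Λ : ℝ) (x : FreqBand) : ℂ := fderiv ℝ (uvSymbol₂ c Λ) x fbE1

/-- `∂_eΨ` is smooth. [cite: Salmhofer1999, §4.2.5 (4.70)] -/
theorem contDiff_uvSymbol₂E (c : ℝ) {Λ : ℝ} (hΛ : 0 < Λ) {n : ℕ∞} : ContDiff ℝ n (uvSymbol₂E c Λ) := by
  have h : ContDiff ℝ n (fderiv ℝ (uvSymbol₂ c Λ)) := (contDiff_uvSymbol₂ c hΛ (n := n + 1)).fderiv_right le_rfl
  exact h.clm_apply contDiff_const

/-- `‖Dⁱ(∂_eΨ)(x)‖ ≤ ‖D^{i+1}Ψ(x)‖`. [cite: BenfattoGiulianiMastropietro2006, (2.36aa)] -/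
theorem norm_iteratedFDeriv_uvSymbol₂E_le (c : ℝ) {Λ : ℝ} (hΛ : 0 < Λ) (i : ℕ) (x : FreqBand) :
    ‖iteratedFDeriv ℝ i (uvSymbol₂E c Λ) x‖ ≤ ‖iteratedFDeriv ℝ (i + 1) (uvSymbol₂ c Λ) x‖ := by
  have hf : ContDiffAt ℝ i (fderiv ℝ (uvSymbol₂ c Λ)) x :=
    ((contDiff_uvSymbol₂ c hΛ (n := (i : ℕ∞) + 1)).fderiv_right le_rfl).contDiffAt
  have h := norm_iteratedFDeriv_clm_apply_const (c := fbE1) hf le_rfl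
  rw [norm_fbE1, one_mul, norm_iteratedFDeriv_fderiv] at h
  exact h

/-- **The telescoping integrand**: `‖Dᵇ(∂_eΨ(ω, u ·)·κ)(p)‖ ≤ Σ_{j ≤ b} C(b,j)·(j!·C'·Dʲ)·‖D^{b-j}κ(p)‖` when `‖D^{i+1}Ψ(ω, u p)‖ ≤ C'` for `i ≤ b`,
`‖Dⁱu(p)‖ ≤ Dⁱ` for `1 ≤ i ≤ b` (`u`, `κ ∈ Cᵇ`). [cite: BenfattoGiulianiMastropietro2006, (2.36aa) and §3 (3.2)] -/
theorem norm_iteratedFDeriv_uvSymbol₂E_comp_mul_le {c Λ : ℝ} (hΛ : 0 < Λ) {b : ℕ} {u κ : E → ℝ} (hu : ContDiff ℝ b u)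
    (hκ : ContDiff ℝ b κ) (ω : ℝ) (p : E) {C' D : ℝ} (hC' : ∀ i ≤ b, ‖iteratedFDeriv ℝ (i + 1) (uvSymbol₂ c Λ) (fbPt ω (u p))‖ ≤ C')
    (hD : ∀ i, 1 ≤ i → i ≤ b → ‖iteratedFDeriv ℝ i u p‖ ≤ D ^ i) :
    ‖iteratedFDeriv ℝ b (fun p => uvSymbol₂E c Λ (fbPt ω (u p)) * ((κ p : ℝ) : ℂ)) p‖ ≤
      ∑ j ∈ Finset.range (b + 1), (b.choose j : ℝ) * (j ! * C' * D ^ j) * ‖iteratedFDeriv ℝ (b - j) κ p‖ := by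
  have hf : ContDiff ℝ b (fun p => uvSymbol₂E c Λ (fbPt ω (u p))) := (contDiff_uvSymbol₂E c hΛ (n := b)).comp (contDiff_fbPt_comp hu ω)
  have hg : ContDiff ℝ b (fun p => ((κ p : ℝ) : ℂ)) := Complex.ofRealCLM.contDiff.comp hκ
  have hL := norm_iteratedFDeriv_mul_le (N := (b : ℕ∞)) hf hg p (n := b) le_rfl
  refine hL.trans (Finset.sum_le_sum fun j hj => ?_)
  have hjb : j ≤ b := Nat.lt_succ_iff.1 (Finset.mem_range.1 hj)
  have h1 : ‖iteratedFDeriv ℝ j (fun p => uvSymbol₂E c Λ (fbPt ω (u p))) p‖ ≤ j ! * C' * D ^ j := by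
    have h := norm_iteratedFDeriv_comp_le (g := uvSymbol₂E c Λ) (f := fun p => fbPt ω (u p)) (N := (j : ℕ∞))
      (contDiff_uvSymbol₂E c hΛ) (contDiff_fbPt_comp (hu.of_le (by exact_mod_cast hjb)) ω) le_rfl p
      (fun i hi => (norm_iteratedFDeriv_uvSymbol₂E_le c hΛ i _).trans (hC' i (hi.trans hjb)))
      (fun i hi1 hij => by
        rw [norm_iteratedFDeriv_fbPt_comp hi1 (hu.of_le (by exact_mod_cast (hij.trans hjb))) ω p]
        exact hD i hi1 (hij.trans hjb))
    exact h
  have h2 : ‖iteratedFDeriv ℝ (b - j) (fun p => ((κ p : ℝ) : ℂ)) p‖ = ‖iteratedFDeriv ℝ (b - j) κ p‖ := by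
    have h : (fun p => ((κ p : ℝ) : ℂ)) = Complex.ofRealLI ∘ κ := rfl
    rw [h, Complex.ofRealLI.norm_iteratedFDeriv_comp_left ((hκ.of_le (by exact_mod_cast Nat.sub_le b j)).contDiffAt) le_rfl]
  rw [h2]
  have hC'0 : 0 ≤ C' := (norm_nonneg _).trans (hC' 0 (Nat.zero_le _))
  exact mul_le_mul_of_nonneg_right (mul_le_mul_of_nonneg_left h1 (Nat.cast_nonneg _)) (norm_nonneg _)

/-! ### §5 Increments through an interpolation parameter: lattice mixed differences of `Ψ(ω, v) − Ψ(ω, v′)` -/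

section Interp

variable {X : Type*} [AddCommGroup X]

/-- **Derivatives in a parameter commute with iterated lattice differences**: if `s ↦ F s x` has derivative `F' s x` for every `x`, then
`s ↦ (Δ_v)^n (F s) x` has derivative `(Δ_v)^n (F' s) x`. [cite: BenfattoGiulianiMastropietro2006, (2.36aa)] -/
theorem hasDerivAt_fwdDiff_iter_family {F F' : ℝ → X → ℂ} (hF : ∀ s x, HasDerivAt (fun s => F s x) (F' s x) s) (v : X) :
    ∀ (n : ℕ) (s : ℝ) (x : X), HasDerivAt (fun s => (fwdDiff v)^[n] (F s) x) ((fwdDiff v)^[n] (F' s) x) s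
  | 0, s, x => hF s x
  | n + 1, s, x => by
    have h1 := hasDerivAt_fwdDiff_iter_family hF v n s (x + v)
    have h2 := hasDerivAt_fwdDiff_iter_family hF v n s x
    simp only [Function.iterate_succ_apply', fwdDiff]
    exact h1.sub h2

/-- The same for mixed iterated differences in two directions. [cite: BenfattoGiulianiMastropietro2006, (2.36aa)] -/
theorem hasDerivAt_fwdDiff_iter₂_family {F F' : ℝ → X → ℂ} (hF : ∀ s x, HasDerivAt (fun s => F s x) (F' s x) s) (u v : X)
    (a b : ℕ) (s : ℝ) (x : X) :
    HasDerivAt (fun s => (fwdDiff u)^[a] ((fwdDiff v)^[b] (F s)) x) ((fwdDiff u)^[a] ((fwdDiff v)^[b] (F' s)) x) s :=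
  hasDerivAt_fwdDiff_iter_family (F := fun s => (fwdDiff v)^[b] (F s)) (F' := fun s => (fwdDiff v)^[b] (F' s))
    (fun s x => hasDerivAt_fwdDiff_iter_family hF v b s x) u a s x

/-- **The mean value bound for an increment**: `‖(Δ_u)^a(Δ_v)^b (F 1) x − (Δ_u)^a(Δ_v)^b (F 0) x‖ ≤ sup_{s ∈ [0,1)} ‖(Δ_u)^a(Δ_v)^b (F' s) x‖`.
[cite: BenfattoGiulianiMastropietro2006, (2.36aa) and §3 (3.2)] -/
theorem norm_fwdDiff_iter₂_sub_le_of_family {F F' : ℝ → X → ℂ} (hF : ∀ s x, HasDerivAt (fun s => F s x) (F' s x) s) (u v : X)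
    (a b : ℕ) (x : X) {C : ℝ} (hC : ∀ s ∈ Ico (0 : ℝ) 1, ‖(fwdDiff u)^[a] ((fwdDiff v)^[b] (F' s)) x‖ ≤ C) :
    ‖(fwdDiff u)^[a] ((fwdDiff v)^[b] (F 1)) x - (fwdDiff u)^[a] ((fwdDiff v)^[b] (F 0)) x‖ ≤ C :=
  norm_image_sub_le_of_norm_deriv_le_segment_01' (f := fun s => (fwdDiff u)^[a] ((fwdDiff v)^[b] (F s)) x)
    (fun s _ => (hasDerivAt_fwdDiff_iter₂_family hF u v a b s x).hasDerivWithinAt) hC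

end Interp

/-- **The interpolating family of an increment of bands**: for lattice functions `v, w : X → ℝ`,
`s ↦ Ψ(ω, v(x) + s·w(x))` has derivative `w(x)·∂_eΨ(ω, v(x) + s·w(x))`. [cite: BenfattoGiulianiMastropietro2006, (2.36aa) and §3 (3.2)] -/
theorem hasDerivAt_uvSymbol₂_fbPt_interp (c : ℝ) {Λ : ℝ} (hΛ : 0 < Λ) (ω v w s : ℝ) :
    HasDerivAt (fun s => uvSymbol₂ c Λ (fbPt ω (v + s * w))) (((w : ℝ) : ℂ) * uvSymbol₂E c Λ (fbPt ω (v + s * w))) s := by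
  -- the path `s ↦ (ω, v + s w)` has derivative `w • e₁`
  have hpath : HasDerivAt (fun s => fbPt ω (v + s * w)) (w • fbE1) s := by
    have h : (fun s : ℝ => fbPt ω (v + s * w)) = fun s => fbPt ω v + (s * w) • fbE1 := by
      funext t; simp only [fbPt, add_smul]; abel
    rw [h]
    have h1 : HasDerivAt (fun s : ℝ => s * w) w s := by simpa using (hasDerivAt_id s).mul_const w
    exact (h1.smul_const fbE1).const_add _
  have hΨ : HasFDerivAt (uvSymbol₂ c Λ) (fderiv ℝ (uvSymbol₂ c Λ) (fbPt ω (v + s * w))) (fbPt ω (v + s * w)) :=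
    ((contDiff_uvSymbol₂ c hΛ (n := 1)).differentiable one_ne_zero _).hasFDerivAt
  have h := hΨ.comp_hasDerivAt s hpath
  have heq : (fderiv ℝ (uvSymbol₂ c Λ) (fbPt ω (v + s * w))) (w • fbE1) = ((w : ℝ) : ℂ) * uvSymbol₂E c Λ (fbPt ω (v + s * w)) := by
    rw [map_smul, uvSymbol₂E, Complex.real_smul]
  rw [← heq]
  exact h

/-- **Mixed lattice differences of an increment of composed symbols are bounded by those of the interpolating integrand**:
with `G_s(x) = Ψ(ω, v(x) + s·w(x))` and `H_s(x) = w(x)·∂_eΨ(ω, v(x) + s·w(x))`,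
`‖(Δ_u)^a(Δ_v)^b G_1 (x) − (Δ_u)^a(Δ_v)^b G_0 (x)‖ ≤ sup_{s ∈ [0,1)} ‖(Δ_u)^a(Δ_v)^b H_s (x)‖`. [cite: BenfattoGiulianiMastropietro2006, (2.36aa) and §3 (3.2)] -/
theorem norm_fwdDiff_iter₂_uvSymbol₂_increment_le {X : Type*} [AddCommGroup X] (c : ℝ) {Λ : ℝ} (hΛ : 0 < Λ) (ω : ℝ) (v w : X → ℝ)
    (u₁ u₂ : X) (a b : ℕ) (x : X) {C : ℝ}
    (hC : ∀ s ∈ Ico (0 : ℝ) 1, ‖(fwdDiff u₁)^[a] ((fwdDiff u₂)^[b] (fun y => ((w y : ℝ) : ℂ) * uvSymbol₂E c Λ (fbPt ω (v y + s * w y)))) x‖ ≤ C) :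
    ‖(fwdDiff u₁)^[a] ((fwdDiff u₂)^[b] (fun y => uvSymbol₂ c Λ (fbPt ω (v y + w y)))) x -
        (fwdDiff u₁)^[a] ((fwdDiff u₂)^[b] (fun y => uvSymbol₂ c Λ (fbPt ω (v y)))) x‖ ≤ C := by
  have h := norm_fwdDiff_iter₂_sub_le_of_family (F := fun s y => uvSymbol₂ c Λ (fbPt ω (v y + s * w y)))
    (F' := fun s y => ((w y : ℝ) : ℂ) * uvSymbol₂E c Λ (fbPt ω (v y + s * w y)))
    (fun s y => hasDerivAt_uvSymbol₂_fbPt_interp c hΛ ω (v y) (w y) s) u₁ u₂ a b x hC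
  simpa only [one_mul, zero_mul, add_zero] using h

end Literature.MathematicalPhysics.QuantumLattice

end
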